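import Summits.BirchSwinnertonDyer.BirchSwinnertonDyer.Theorems.AdditiveBranchIMCGordTwoRankOneHeegnerKolyvaginHorizontalCertificate
import Summits.BirchSwinnertonDyer.BirchSwinnertonDyer.Theorems.AdditiveKolyvaginRoadManinFrameFromDatum
import Summits.BirchSwinnertonDyer.BirchSwinnertonDyer.Theorems.AdditiveKolyvaginRoadIstarIsogenyInvariance
import Summits.BirchSwinnertonDyer.Rank1Residual.Additive.GordBranchMeetsField
import HarnessLib

/-!
# Route `AdditiveBranchIMC` (rung K1), crux `GordTwoRankOne` (item 19358): the Heegner–Kolyvagin road,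
# Part 18 — the MANIN RIDER RETIRED on the whole cell (G-ord, `e = 2`) at EVERY odd prime: Kodaira `I₀*`
# ⟹ Mazur–Stevens, from CITE-ONLY published facts (Mazur 1978, Abbes–Ullmo 1996, Česnavičius 2018)
# (cell `bsd-addord`, second prover lane `bsd-addord-k1-c3x`, gen 4; `--supports` only)

HONEST FRAMING. THEOREMS ONLY: no definition, no new named fact, no `sorry`; nothing is booked; crux 19358
and item 20498 stay OPEN at class level; BSD is not proved by any of this. The sibling route
`AdditiveKolyvaginRoad` (cell `pub/bsd-wall`) is consumed BY NAME — here its ROUTE-INDEPENDENT machinery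
behind the CLOSED item 20093 `ManinFrameIstarClass` (`ManinFrameFromDatum.…`, `IstarIsogenyInvariance.…`,
seat `bsd-wall-akr-p2`); none of its files is touched.

WHY. On lane B's road the Manin constant enters ONE place: the Heegner datum used by Kolyvagin's bound
(Part 6, UPPER) and by McCallum's index door (Parts 17b–17d, LOWER) must have `p ∤ c(Dt)`. Gens 0–3
discharged it at `p ≥ 11` by Edixhoven 1991 Thm. 3 (gen 0 Part 2, binders `hmodP hEdxK hNS`) and, at
`p ∈ {5, 7}`, took the sibling's OPEN crux `ManinGoodOddFrameAdditive` (item 20136, binder `hM`) — open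
because of its residue child 20094 (Kodaira types II/III/IV, `e ∈ {3,4,6}`); at `p = 3` the rider stayed
DISPLAYED (Part 17d `hMan3`). But cell (G-ord, `e = 2`) is Kodaira type `I₀*` at `p`, at EVERY odd `p`
(`p = 3` included): the `p*`-twist of `W` has GOOD reduction at `p`
(`TypeGOrd.exists_goodOrd_model_twist_pStar`, all odd `p`), so `W ≅ C • V^{(p*)}` with `V` good at `p`,
and Tate's algorithm Steps 6–7 (`Additive.kodairaSymbolAt_twist_of_semistable`) return `Iₙ*`. On type `Iₙ*`
the Manin constant of the `X₀(N)`-optimal curve is prime to the odd `p` by the «Mazur–Stevens» clause of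
Edixhoven 1991 §1 — Stevens 1989 (5.2)/(5.4) PROVED in the tree (`not_dvd_maninConstant_of_kodairaSymbolAt_eq_Istar`),
modulo the CITE-ONLY facts Mazur 1978 Cor. 4.1 (`hMz`), Abbes–Ullmo 1996 Thm. A (`hAU`), Česnavičius 2018
Thm. 1.2 (`hC2`, used at `2` only inside that tree theorem) and modularity (`hnf`) — and the sibling's
`exists_modularParametrizationData_not_dvd_of_istarClass` transports it to every member of the class with
`E[p]` irreducible (Néron, `p ∤ k`). HENCE (this file):
* §29 `N10.exists_kodairaSymbolAt_eq_Istar_of_cellGordTwo` — the cell is of type `Iₙ*` at `p` (every odd `p`);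
* §30 `exists_modularParametrizationData_not_dvd_of_cellGordTwo_of_irr` — a datum with `p ∤ c` on every
  `Irr` row of the cell at EVERY odd `p` (gen 0 Part 2's theorem had `7 < p`); the odd Hoffstein–Luo frame
  (`exists_oddHeegnerFrame_of_cellGordTwo`: the CONCLUSION of item 20136 on the cell, from PUB) and the
  Manin-unit datum at a given Heegner field (`exists_maninDatum_of_cellGordTwo_of_irr`);
* §31 Part 17d's certificate road with NO Manin rider at ANY odd `p`: `gordTwoRankOne_of_certificates_pub_of_rest`
  — crux BY NAME ⟸ PUB (`hPub hKatoT hLLT hMz hAU hC2`) + BSD-depth Kolyvagin certificates on the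
  tower-surjective rows + the displayed non-tower-surjective complement (Part 8's complement, nothing else);
* (sibling file `…HeegnerKolyvaginManinIstarSharp`, Part 18b) Parts 17b/17c/§25 on the ♯ rows and Part 11's
  CLASS-LEVEL `BSD(E,p)` restated at `p ≥ 5` with item 20136 / Edixhoven REMOVED.
NET for the K1 books: the inter-route edge «19358 ♯ rows ⟸ 20418 + 20136 + PUB» (plan E263) loses 20136 at
every `p ≥ 5`; the certificate road (17d) has no Manin rider left at any odd `p`.

References: [EdixhovenManin1991] §1 («Mazur–Stevens»); [Stevens1989] (5.2), (5.4); [Mazur1978] Cor. 4.1;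
[AbbesUllmo1996] Thm. A; [Cesnavicius2018] Thm. 1.2; [SilvermanATAEC1994] IV.9.4 Steps 6–7, Table 4.1;
[McCallumLMS1991] §5; [JetchevSkinnerWan2017] §7.4.1–7.4.3; [Kato2004Asterisque] Thm. 14.5 (3);
[HoffsteinLuo1997] §1; [FriedbergHoffstein1995]; [LiLiuTian2024] Thm. 1.1; [Miller2011LMS] Def. 1.1.
-/

set_option autoImplicit false
set_option linter.dupNamespace false
noncomputable section
open scoped Classical NumberField
open WeierstrassCurve NumberField IsDedekindDomain IsDedekindDomain.HeightOneSpectrum Rat.HeightOneSpectrum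
  Literature.NumberTheory.DiophantineGeometry Literature.NumberTheory.EllipticCurves
  Literature.NumberTheory.EllipticCurves.ModularForms Literature.NumberTheory.EllipticCurves.Rank1Residual
  Literature.NumberTheory.EllipticCurves.Rank1Residual.Typed Literature.NumberTheory.Automorphic
  Summit.BirchSwinnertonDyer.Rank1Residual Summit.BirchSwinnertonDyer.Rank1Residual.Additive
  Summit.BirchSwinnertonDyer.Rank1Residual.X11b Summit.BirchSwinnertonDyer.Rank1Residual.GaloisImage
  Summit.BirchSwinnertonDyer.BirchSwinnertonDyer.Theses.AdditiveKolyvaginRoad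
  Summit.BirchSwinnertonDyer.BirchSwinnertonDyer.Theorems.AdditiveKolyvaginKernel
  Summit.BirchSwinnertonDyer.BirchSwinnertonDyer.Theorems

namespace Summit.BirchSwinnertonDyer.BirchSwinnertonDyer.Theorems.AdditiveBranchIMCGordTwoRankOne.HeegnerKolyvagin

/-! ### §29 Cell (G-ord, `e = 2`) is of Kodaira type `Iₙ*` at `p` — every odd `p` -/

/-- **Cell (G-ord, `e = 2`) is of Kodaira type `Iₙ*` at the place of `ℤ` under `p`, at EVERY odd `p`.** For
`W/ℚ` globally minimal on `N10.CellGordTwo W p` (`p` odd, additive, (G)-ordinary, semistability index `2`):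
the `p*`-twist `V` of `W` has GOOD reduction at `p` (`TypeGOrd.exists_goodOrd_model_twist_pStar`, valid at
`p = 3` too), `W ≅ C • V^{(p*)}` (`exists_variableChange_quadraticTwist_symm`) with `p ∥ p*`, so Tate's
algorithm Steps 6–7 (`Additive.kodairaSymbolAt_twist_of_semistable`) return `Iₙ*` at the place over `p`
(read at the place of `𝓞 ℚ`, moved to the place of `ℤ` by `O5.FlexNormalForm.kodairaSymbolAt_eq_of_primesEquiv_eq'`).
The shape is the class hypothesis of the sibling's item 20093 read on one member. (In fact `n = 0`; not needed.)
[cite: SilvermanATAEC1994, IV.9.4 Steps 6–7 (PDF pp. 345–346) and Table 4.1] -/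
theorem N10.exists_kodairaSymbolAt_eq_Istar_of_cellGordTwo
    (W : WeierstrassCurve ℚ) [W.IsElliptic] [W.IsGloballyMinimal] (p : ℕ) [Fact p.Prime]
    (hc2 : N10.CellGordTwo W p) :
    ∃ (v : HeightOneSpectrum ℤ) (n : ℕ), natGenerator v = p ∧ W.kodairaSymbolAt v = .Istar n := by
  have hp : p.Prime := Fact.out
  obtain ⟨hp2, hadd, hG, he⟩ := hc2
  -- the `p*`-twist `V` of `W`, globally minimal, GOOD at `p`
  obtain ⟨V, _, _, ⟨C, hC⟩, hord⟩ := TypeGOrd.exists_goodOrd_model_twist_pStar W p hp2 hG hadd he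
  have hVgood : V.HasGoodReductionAtPrime p := hord.1
  -- `p* = (−1)^{⌊p/2⌋} p` as an integer
  set d : ℤ := (-1 : ℤ) ^ (p / 2) * p with hd
  obtain ⟨hd0, h1, h2⟩ := IstarIsogenyInvariance.pStar_dvd_facts hp
  have hdQ : ((d : ℤ) : ℚ) = (-1 : ℚ) ^ (p / 2) * p := by push_cast [hd]; ring
  have hd0Q : (d : ℚ) ≠ 0 := by exact_mod_cast hd0
  -- `W ≅ C' • V^{(p*)}`
  have hC' : C • W.quadraticTwist (d : ℚ) = V := by rw [hdQ]; exact hC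
  obtain ⟨C', hC'W⟩ := exists_variableChange_quadraticTwist_symm V W hd0Q ⟨C, hC'⟩
  -- the place of `𝓞 ℚ` over `p`
  set v' : HeightOneSpectrum (𝓞 ℚ) := (primesEquiv (R := 𝓞 ℚ)).symm ⟨p, hp⟩ with hv'
  have hkey : primesEquiv v' = ⟨p, hp⟩ := (primesEquiv (R := 𝓞 ℚ)).apply_symm_apply _
  have hvnat : ((primesEquiv v' : Nat.Primes) : ℕ) = p := congrArg Subtype.val hkey
  have hv2 : ((primesEquiv v' : Nat.Primes) : ℕ) ≠ 2 := by rw [hvnat]; exact hp2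
  -- `V` is good at `v'`
  have hVv : V.HasGoodReductionAt v' := by
    have hiff := hasGoodReductionAtPrime_iff_hasGoodReductionAt_ringOfIntegers v' V
    simp only [hkey] at hiff
    exact hiff.mp hVgood
  -- Tate's algorithm Steps 6–7 on `W = C' • V^{(p*)}`
  obtain ⟨n, hn⟩ := Additive.kodairaSymbolAt_twist_of_semistable v' V hv2 hd0
    (by rw [hvnat]; exact h1) (by rw [hvnat]; exact h2) (Or.inl hVv) C' hC'W
  -- move to the place of `ℤ` under `p`
  set v : HeightOneSpectrum ℤ := (primesEquiv (R := ℤ)).symm ⟨p, hp⟩ with hv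
  have hkeyZ : primesEquiv v = ⟨p, hp⟩ := (primesEquiv (R := ℤ)).apply_symm_apply _
  have hvv' : primesEquiv v = primesEquiv v' := by rw [hkeyZ, hkey]
  refine ⟨v, n, congrArg Subtype.val hkeyZ, ?_⟩
  rw [O5.FlexNormalForm.kodairaSymbolAt_eq_of_primesEquiv_eq' W v v' hvv']
  exact hn

/-- **The class hypothesis of the sibling's item 20093 (`ManinFrameIstarClass`) HOLDS on the cell**: every
globally minimal `W₀ ∼ W` is of type `Iₘ*` at a place of `ℤ` with generator `p` (type `Iₙ*` at an odd prime
is a `ℚ`-isogeny invariant, `IstarIsogenyInvariance.istarClass_of_kodairaSymbolAt_eq_Istar`).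
[cite: SilvermanATAEC1994, IV.9.4 Steps 6–7] -/
theorem N10.istarClass_of_cellGordTwo
    (W : WeierstrassCurve ℚ) [W.IsElliptic] [W.IsGloballyMinimal] (p : ℕ) [Fact p.Prime]
    (hc2 : N10.CellGordTwo W p) :
    ∀ (W₀ : WeierstrassCurve ℚ) [W₀.IsElliptic] [W₀.IsGloballyMinimal], IsIsogenous W W₀ →
      ∃ (v : HeightOneSpectrum ℤ) (n : ℕ), natGenerator v = p ∧ W₀.kodairaSymbolAt v = .Istar n := by
  obtain ⟨v, n, hv, hK⟩ := N10.exists_kodairaSymbolAt_eq_Istar_of_cellGordTwo W p hc2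
  exact IstarIsogenyInvariance.istarClass_of_kodairaSymbolAt_eq_Istar hc2.1 v hv hK

/-! ### §30 A datum with `p ∤ c`, the odd Hoffstein–Luo frame, and the Manin-unit datum — on the cell, every odd `p` -/

/-- **A parametrisation datum of `W` at level `N(W)` with Manin constant PRIME TO `p`, on EVERY `Irr` row of
cell (G-ord, `e = 2`) at EVERY odd `p`** (`p = 3, 5, 7` included; compare gen 0 Part 2's
`exists_modularParametrizationData_not_dvd_of_cellGordTwo`, `7 < p`, Edixhoven). PUBLISHED inputs, cite-only:
modularity `hnf`, Mazur 1978 Cor. 4.1 `hMz`, Abbes–Ullmo 1996 Thm. A `hAU`, Česnavičius 2018 Thm. 1.2 `hC2`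
(the binders of the sibling's `exists_modularParametrizationData_not_dvd_of_istarClass`, whose class
hypothesis is §29). [cite: EdixhovenManin1991, §1 (typescript L96–101)] [cite: Stevens1989, Lemmas (5.2), (5.4)]
[cite: Mazur1978, Cor. 4.1] [cite: AbbesUllmo1996, Thm. A] [cite: Cesnavicius2018, Thm. 1.2] -/
theorem exists_modularParametrizationData_not_dvd_of_cellGordTwo_of_irr (hnf : exists_isNewformOf)
    (hMz : mazur_not_dvd_maninConstant_of_odd)
    (hAU : abbesUllmo_not_dvd_maninConstant_of_not_dvd_level)
    (hC2 : cesnavicius_not_two_dvd_maninConstant_of_two_dvd_level)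
    (W : WeierstrassCurve ℚ) [W.IsElliptic] [W.IsGloballyMinimal] [NeZero (W.conductorNorm ℤ)]
    (p : ℕ) [Fact p.Prime] (hc2 : N10.CellGordTwo W p) (hirr : Irr W p) :
    ∃ Dt : ModularParametrizationData W (W.conductorNorm ℤ), ¬ (p : ℤ) ∣ Dt.c :=
  ManinFrameFromDatum.exists_modularParametrizationData_not_dvd_of_istarClass hnf hMz hAU hC2 W rfl p hc2.1 hirr
    (N10.istarClass_of_cellGordTwo W p hc2)

/-- **The Manin rider of Part 17d (`hMan`) DISCHARGED on the cell at every odd `p` from cite-only PUB**: on every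
rank-one tower-surjective row of cell (G-ord, `e = 2`) a datum at level `N(W)` with `p ∤ c` (tower-surjective
⟹ `E[p]` irreducible). [cite: EdixhovenManin1991, §1] [cite: Stevens1989, Lemmas (5.2), (5.4)]
[cite: Mazur1978, Cor. 4.1] [cite: AbbesUllmo1996, Thm. A] [cite: Cesnavicius2018, Thm. 1.2] -/
theorem maninRider_cellGordTwo_of_pub (hnf : exists_isNewformOf)
    (hMz : mazur_not_dvd_maninConstant_of_odd)
    (hAU : abbesUllmo_not_dvd_maninConstant_of_not_dvd_level)
    (hC2 : cesnavicius_not_two_dvd_maninConstant_of_two_dvd_level) :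
    ∀ (W : WeierstrassCurve ℚ) [W.IsElliptic] [W.IsGloballyMinimal] (p : ℕ) [Fact p.Prime]
      [NeZero (W.conductorNorm ℤ)], W.analyticRank = 1 → N10.CellGordTwo W p →
      (∀ m : ℕ, W.HasSurjectiveModNGaloisRep (p ^ m : ℕ)) →
      ∃ Dt : ModularParametrizationData W (W.conductorNorm ℤ), ¬ (p : ℤ) ∣ Dt.c := by
  intro W _ _ p _ _ _ hc2 hsurj
  have hsurjp : W.HasSurjectiveModNGaloisRep p := by simpa using hsurj 1
  exact exists_modularParametrizationData_not_dvd_of_cellGordTwo_of_irr hnf hMz hAU hC2 W p hc2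
    (hasIrreducibleModPGaloisRep_of_hasSurjectiveModNGaloisRep W p hsurjp)

/-- **The CONCLUSION of the sibling's crux `ManinGoodOddFrameAdditive` (item 20136) HOLDS on cell (G-ord,
`e = 2`)** from cite-only PUB: for `W/ℚ` globally minimal with `r_an = 1` on an `Irr` row of the cell at an odd
`p`, a Hoffstein–Luo field `K` (`d_K` odd, `p ∤ d_K`, every `ℓ ∣ N` split, `L(E^{d_K},1) ≠ 0`, `p ∤ w_K`), a
datum with `p ∤ c`, its Heegner point `P ∈ E(K)` and a globally minimal model of the twist
(`ManinFrameFromDatum.exists_oddHeegnerFrame_of_exists_not_dvd` on §30's datum). Extra binder: Hoffstein–Luo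
(`hHL`). [cite: HoffsteinLuo1997, Theorem (§1, pp. 435–436)] [cite: Darmon2004, Thm. 3.6]
[cite: EdixhovenManin1991, §1] [cite: Mazur1978, Cor. 4.1] [cite: AbbesUllmo1996, Thm. A] -/
theorem exists_oddHeegnerFrame_of_cellGordTwo (hnf : exists_isNewformOf)
    (hHL : HoffsteinLuo1997_exists_twist_L_one_ne_zero)
    (hMz : mazur_not_dvd_maninConstant_of_odd)
    (hAU : abbesUllmo_not_dvd_maninConstant_of_not_dvd_level)
    (hC2 : cesnavicius_not_two_dvd_maninConstant_of_two_dvd_level)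
    (W : WeierstrassCurve ℚ) [W.IsElliptic] [W.IsGloballyMinimal] [NeZero (W.conductorNorm ℤ)]
    (p : ℕ) [Fact p.Prime] (hc2 : N10.CellGordTwo W p) (hirr : Irr W p) (hr : W.analyticRank = 1) :
    ∃ (K : Type) (_ : Field K) (_ : NumberField K)
      (Dt : ModularParametrizationData W (W.conductorNorm ℤ))
      (H : HeegnerDatum (W.conductorNorm ℤ) (NumberField.discr K)) (ι : K →+* ℂ)
      (P : (W.baseChange K).toAffine.Point)
      (Wd : WeierstrassCurve ℚ) (_ : Wd.IsElliptic) (_ : Wd.IsGloballyMinimal) (Cd : VariableChange ℚ),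
      IsImaginaryQuadratic K ∧ Odd (NumberField.discr K) ∧ ¬ (p : ℤ) ∣ NumberField.discr K ∧
        SatisfiesHeegnerHypothesis (W.conductorNorm ℤ) K ∧
        WeierstrassCurve.Affine.Point.map ι.toRatAlgHom P = heegnerPointComplex Dt H ∧
        ¬ (p : ℤ) ∣ Dt.c ∧ ¬ p ∣ Units.torsionOrder K ∧
        (W.quadraticTwist (NumberField.discr K : ℚ)).entireLFunction 1 ≠ 0 ∧
        Cd • W.quadraticTwist (NumberField.discr K : ℚ) = Wd :=
  ManinFrameFromDatum.exists_oddHeegnerFrame_of_exists_not_dvd hnf hHL W p hr hc2.1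
    (exists_modularParametrizationData_not_dvd_of_cellGordTwo_of_irr hnf hMz hAU hC2 W p hc2 hirr)

/-- **The Manin-unit Heegner datum at a GIVEN Heegner field, on the cell, every odd `p`** (gen 0 Part 2's
`exists_maninDatum_of_cellGordTwo` had `7 < p`): for `K` imaginary quadratic Heegner for `N(W)`, a datum `Dt`
with `p ∤ c(Dt)`, a Heegner datum `H` of discriminant `d_K`, `ι : K → ℂ` and `P ∈ E(K)` over the complex Heegner
point (Darmon 2004 Thm. 3.6). [cite: Darmon2004, Thm. 3.6–3.7 (PDF pp. 43–44)] [cite: EdixhovenManin1991, §1]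
[cite: Mazur1978, Cor. 4.1] [cite: AbbesUllmo1996, Thm. A] [cite: Cesnavicius2018, Thm. 1.2] -/
theorem exists_maninDatum_of_cellGordTwo_of_irr (hnf : exists_isNewformOf)
    (hMz : mazur_not_dvd_maninConstant_of_odd)
    (hAU : abbesUllmo_not_dvd_maninConstant_of_not_dvd_level)
    (hC2 : cesnavicius_not_two_dvd_maninConstant_of_two_dvd_level)
    (W : WeierstrassCurve ℚ) [W.IsElliptic] [W.IsGloballyMinimal] [NeZero (W.conductorNorm ℤ)]
    (p : ℕ) [Fact p.Prime] (K : Type) [Field K] [NumberField K]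
    (hc2 : N10.CellGordTwo W p) (hirr : Irr W p)
    (hK : IsImaginaryQuadratic K) (hH : SatisfiesHeegnerHypothesis (W.conductorNorm ℤ) K) :
    ∃ (Dt : ModularParametrizationData W (W.conductorNorm ℤ))
      (H : HeegnerDatum (W.conductorNorm ℤ) (NumberField.discr K))
      (ι : K →+* ℂ) (P : (W.baseChange K).toAffine.Point),
      WeierstrassCurve.Affine.Point.map ι.toRatAlgHom P = heegnerPointComplex Dt H ∧
        ¬ (p : ℤ) ∣ Dt.c :=
  ManinFrameFromDatum.exists_maninDatum_of_exists_not_dvd W p (W.conductorNorm ℤ) K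
    (exists_modularParametrizationData_not_dvd_of_cellGordTwo_of_irr hnf hMz hAU hC2 W p hc2 hirr) hK hH

/-! ### §31 Part 17d's certificate road with NO Manin rider, at ANY odd `p` -/

/-- **CLASS LEVEL, ALL tower-surjective rows of cell (G-ord, `e = 2`) ∩ `r_an = 1`, EVERY ODD `p`, NO RIDER.**
Part 17d's `cellGordTwo_missingLowerBoundAt_rankOne_towerSurj_of_certificates` with its Manin rider `hMan`
DISCHARGED (§30): `Typed.MissingLowerBoundAt W p` from PUB (`hPub`, `hKatoT`, cite-only `hMz hAU hC2`) and the
displayed BSD-DEPTH CERTIFICATES (`hCert`: at every odd Manin-good frame of every such row a Kolyvagin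
certificate of depth `≤ ord_p ∏c_ℓ(E)` — Kolyvagin's conjecture in McCallum's quantified form, the value BSD
predicts; `p = 3` and `p ∣ ∏c` allowed). [cite: McCallumLMS1991, §5 Cor. 5.6 (p. 310)]
[cite: Kato2004Asterisque, Thm. 14.5 (3) (p. 236)] [cite: EdixhovenManin1991, §1] [cite: Mazur1978, Cor. 4.1]
[cite: AbbesUllmo1996, Thm. A] [cite: Miller2011LMS, Def. 1.1] -/
theorem cellGordTwo_missingLowerBoundAt_rankOne_towerSurj_of_certificates_pub
    (hPub : PublishedInputsAdditiveKoly)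
    (hKatoT : Kato2004.rankZero_padicValNat_sha_add_padicValNat_tamagawa_le_of_additive_potGood_of_imageContainsSL2)
    (hMz : mazur_not_dvd_maninConstant_of_odd)
    (hAU : abbesUllmo_not_dvd_maninConstant_of_not_dvd_level)
    (hC2 : cesnavicius_not_two_dvd_maninConstant_of_two_dvd_level)
    (hCert : ∀ (W : WeierstrassCurve ℚ) [W.IsElliptic] [W.IsGloballyMinimal] (p : ℕ) [Fact p.Prime]
      [NeZero (W.conductorNorm ℤ)] (K : Type) [Field K] [NumberField K]
      (Dt : ModularParametrizationData W (W.conductorNorm ℤ)) (β : ℤ) (ι : K →+* ℂ),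
      W.analyticRank = 1 → N10.CellGordTwo W p → (∀ m : ℕ, W.HasSurjectiveModNGaloisRep (p ^ m : ℕ)) →
      IsImaginaryQuadratic K → Odd (NumberField.discr K) →
      SatisfiesHeegnerHypothesis (W.conductorNorm ℤ) K →
      (W.quadraticTwist (NumberField.discr K : ℚ)).entireLFunction 1 ≠ 0 →
      (4 * (W.conductorNorm ℤ : ℤ)) ∣ β ^ 2 - NumberField.discr K → ¬ (p : ℤ) ∣ Dt.c →
      ∃ M : ℕ, M ≤ padicValNat p W.tamagawaProduct ∧ Three.Koly.CertificateAt Dt β ι p M) :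
    ∀ (W : WeierstrassCurve ℚ) [W.IsElliptic] [W.IsGloballyMinimal] (p : ℕ) [Fact p.Prime],
      W.analyticRank = 1 → N10.CellGordTwo W p →
      (∀ m : ℕ, W.HasSurjectiveModNGaloisRep (p ^ m : ℕ)) → Typed.MissingLowerBoundAt W p :=
  cellGordTwo_missingLowerBoundAt_rankOne_towerSurj_of_certificates hPub hKatoT
    (maninRider_cellGordTwo_of_pub hPub.2.2.2.2.2.1 hMz hAU hC2) hCert

/-- **Crux `GordTwoRankOne` (item 19358) BY NAME on the Kolyvagin-index road, WHOLE tower-surjective locus, NO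
MANIN RIDER AT ANY ODD `p`.** Part 17d's `gordTwoRankOne_of_certificates_of_rest` /
`…_of_maninThree_of_rest` with the rider (`hMan`; resp. Edixhoven `hmodP hEdxK hNS` at `p ≥ 11`, item 20136
`hM` at `p ∈ {5,7}`, `hMan3` displayed at `p = 3`) REPLACED by the cite-only facts `hMz hAU hC2` (§30).
PUBLISHED binders: `hPub` (the sibling's conjunction), `hKatoT`, `hLLT` (CM rows, lane A), `hMz`, `hAU`, `hC2`;
DISPLAYED: the BSD-depth certificates `hCert` on the tower-surjective rows and the crux on the non-CM
NON-tower-surjective rows (`hRest`) — the SAME complement as Part 8 (`gordTwoRankOne_of_adjustedIndexBound_of_rest`),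
whose typed input STEP L′ (item 20498 at every datum) is here the certificates and NOTHING ELSE. Nothing booked;
19358 stays OPEN. [cite: McCallumLMS1991, §5 Cor. 5.6 (p. 310)] [cite: Kato2004Asterisque, Thm. 14.5 (3) (p. 236)]
[cite: LiLiuTian2024, Thm. 1.1 (i)] [cite: EdixhovenManin1991, §1] [cite: Mazur1978, Cor. 4.1]
[cite: AbbesUllmo1996, Thm. A] [cite: Cesnavicius2018, Thm. 1.2] [cite: Miller2011LMS, Def. 1.1] -/
theorem gordTwoRankOne_of_certificates_pub_of_rest
    (hPub : PublishedInputsAdditiveKoly)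
    (hKatoT : Kato2004.rankZero_padicValNat_sha_add_padicValNat_tamagawa_le_of_additive_potGood_of_imageContainsSL2)
    (hLLT : LiLiuTian2024.thm11_bsdp_of_cm_rank_one)
    (hMz : mazur_not_dvd_maninConstant_of_odd)
    (hAU : abbesUllmo_not_dvd_maninConstant_of_not_dvd_level)
    (hC2 : cesnavicius_not_two_dvd_maninConstant_of_two_dvd_level)
    (hCert : ∀ (W : WeierstrassCurve ℚ) [W.IsElliptic] [W.IsGloballyMinimal] (p : ℕ) [Fact p.Prime]
      [NeZero (W.conductorNorm ℤ)] (K : Type) [Field K] [NumberField K]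
      (Dt : ModularParametrizationData W (W.conductorNorm ℤ)) (β : ℤ) (ι : K →+* ℂ),
      W.analyticRank = 1 → N10.CellGordTwo W p → (∀ m : ℕ, W.HasSurjectiveModNGaloisRep (p ^ m : ℕ)) →
      IsImaginaryQuadratic K → Odd (NumberField.discr K) →
      SatisfiesHeegnerHypothesis (W.conductorNorm ℤ) K →
      (W.quadraticTwist (NumberField.discr K : ℚ)).entireLFunction 1 ≠ 0 →
      (4 * (W.conductorNorm ℤ : ℤ)) ∣ β ^ 2 - NumberField.discr K → ¬ (p : ℤ) ∣ Dt.c →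
      ∃ M : ℕ, M ≤ padicValNat p W.tamagawaProduct ∧ Three.Koly.CertificateAt Dt β ι p M)
    (hRest : ∀ (W : WeierstrassCurve ℚ) [W.IsElliptic] [W.IsGloballyMinimal] (p : ℕ) [Fact p.Prime],
      W.analyticRank = 1 → N10.CellGordTwo W p → ¬ W.HasCM →
      ¬ (∀ n : ℕ, W.HasSurjectiveModNGaloisRep (p ^ n : ℕ)) → Typed.MissingLowerBoundAt W p) :
    Summit.BirchSwinnertonDyer.BirchSwinnertonDyer.Theses.AdditiveBranchIMC.GordTwoRankOne :=
  gordTwoRankOne_of_certificates_of_rest hPub hKatoT hLLT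
    (maninRider_cellGordTwo_of_pub hPub.2.2.2.2.2.1 hMz hAU hC2) hCert hRest

end Summit.BirchSwinnertonDyer.BirchSwinnertonDyer.Theorems.AdditiveBranchIMCGordTwoRankOne.HeegnerKolyvagin

end
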